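import Mathlib.Analysis.Fourier.Convolution
import Mathlib.Analysis.Calculus.BumpFunction.InnerProduct
import Mathlib.Analysis.SpecialFunctions.SmoothTransition
import Mathlib.Analysis.SpecialFunctions.Sqrt
import Literature.Analysis.UnboundedOperators.TranslationGroupSmearing
import HarnessLib

/-!
# Half-space spectral condition implies positivity of the energy

Topic `Literature/Analysis/UnboundedOperators`, proofs layer over items C4/C5 (`UnitaryRep`,
`FourierSpectrum`). Let `U` be a strongly continuous unitary representation of the translation
group of a finite-dimensional real inner product space `P` on a complex Hilbert space, with the
distributional spectral condition `U.HasFourierSpectrumIn S` of `FourierSpectrum` (all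
Fourier-transformed matrix coefficients `g ↦ ∫ 𝓕g(a) ⟪φ, U(a)ψ⟫ da` vanish on test functions
supported off `(2π)⁻¹ S`), and let `e ∈ P` be a direction with `S ⊆ {p | 0 ≤ ⟪p, e⟫}`. Then the
Hamiltonian `H_e` of the one-parameter group `t ↦ U(t e) = e^{i t H_e}` is positive,
`0 ≤ ⟪x, H_e x⟫` on `D(H_e)` (`hasPositiveEnergy_alongDirection_of_hasFourierSpectrumIn`).

This is the statement "the spectral condition `supp E ⊆ V̄₊` gives `P⁰ ≥ 0`" of Streater–Wightman,
*PCT, Spin and Statistics, and All That* (1964), §3-1 (spectral condition (3-3)/(3-4) and the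
energy–momentum operators `P^μ`), proved here **without the SNAG/spectral theorem**, directly from
the test-function form of the spectral condition, by a Gårding-vector argument:

1. *Smeared vectors.* For a real symbol `G ∈ C_c^∞(P)` put `k = 𝓕⁻¹G` and `y = ∫ k(a) U(a) x da`.
   By integration by parts and `∂_e 𝓕⁻¹G = 𝓕⁻¹(2πi⟪·,e⟫G)` one has
   `-i ∫ k(a) U(a) A_e x da + ε y = ∫ q(a) U(a) x da` with `q = 𝓕⁻¹((ε - 2π⟪·,e⟫) G)`.
2. *Square root.* With a smooth `r`, `r(v)² = v` for `v ≥ ε/2`, `r = 0` near `v ≤ 0`, the symbol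
   `M = r(ε - 2π⟪·,e⟫) G ∈ C_c^∞` satisfies `(ε - 2π⟪ξ,e⟫) G² - M² = 0` unless `⟪ξ, e⟫ ≥ ε/4π`.
3. *Spectral condition.* Kernels `𝓕⁻¹D` with `D` supported in `{⟪ξ, e⟫ ≥ ε/4π}` smear to `0`
   (`integral_fourierInv_smul_apply_eq_zero`), because `-2πξ ∉ S` there. With the product and
   adjoint formulas for smeared operators (`TranslationGroupSmearing`) and Mathlib's convolution
   theorem `𝓕(k ⋆ q) = 𝓕k · 𝓕q` this gives `⟪y, -i A_e' y + ε y⟫ = ‖∫ m(a) U(a) x da‖² ≥ 0`,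
   i.e. `Im ⟪y, ∫ k U A_e x⟫ ≥ -ε ‖y‖²`.
4. *Approximate identity.* For `G = b(·/R)` (`b` a bump with `b(0) = 1`) the smeared vectors of
   `x` and `A_e x` tend to `x` and `A_e x` as `R → ∞`; hence `Im ⟪x, A_e x⟫ ≥ -ε‖x‖²` for every
   `ε > 0`, and `⟪x, H_e x⟫ = Im ⟪x, A_e x⟫ ≥ 0` (`H_e = -i A_e`).

## References

* R. F. Streater, A. S. Wightman, *PCT, Spin and Statistics, and All That* (1964), §3-1
  (spectral condition, positivity of the energy), §2-6 (2-113)–(2-114). [StreaterWightman1964]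
* M. Reed, B. Simon, *Methods of Modern Mathematical Physics II* (1975), §IX.8 (SNAG theorem, the
  classical route). [ReedSimonII1975]

## Design notes

No definitions. The smooth square root is the explicit function
`v ↦ Real.smoothTransition (4 v / ε - 1) * √v`; symbols are real `C_c^∞` functions turned into
Schwartz maps by `HasCompactSupport.toSchwartzMap`.
-/

noncomputable section

open MeasureTheory Filter Complex FourierTransform
open scoped InnerProductSpace Topology ComplexConjugate SchwartzMap LineDeriv RealInnerProductSpace
  ContDiff

namespace Literature.Analysis.UnboundedOperators

namespace UnitaryRep

variable {P : Type*} [NormedAddCommGroup P] [InnerProductSpace ℝ P] [FiniteDimensional ℝ P]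
  [MeasurableSpace P] [BorelSpace P]
variable {H : Type*} [NormedAddCommGroup H] [InnerProductSpace ℂ H] [CompleteSpace H]

/-! ### The spectral condition kills smeared operators -/

/-- **The spectral condition in smeared form**: if `U` has Fourier spectrum in `S` and the
Schwartz function `g` is supported off `(2π)⁻¹ S`, then `∫ 𝓕g(a) • U(a)ψ da = 0` (its matrix
coefficients are the Fourier-transformed matrix coefficients `U.fourierMatrixCoeff φ ψ g = 0`;
Streater–Wightman (1964), §2-6, (2-113)–(2-114): "`∫ da ρ(a) U(a, 1) = 0`").
[cite: StreaterWightman1964, §2-6 eqs. (2-113)–(2-114)] -/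
theorem integral_fourier_smul_apply_eq_zero (U : UnitaryRep (Multiplicative P) H) {S : Set P}
    (hU : U.HasFourierSpectrumIn S) (g : 𝓢(P, ℂ))
    (hg : tsupport (g : P → ℂ) ⊆ ((fun ξ : P => (2 * Real.pi) • ξ) ⁻¹' S)ᶜ) (ψ : H) :
    ∫ a, (𝓕 g : 𝓢(P, ℂ)) a • U (Multiplicative.ofAdd a) ψ = 0 := by
  refine ext_inner_left ℂ fun φ => ?_
  rw [inner_zero_right, inner_integral_smul_apply U (𝓕 g : 𝓢(P, ℂ)).integrable]
  exact hU φ ψ g hg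

/-- The spectral condition in smeared form, inverse-transform version: if `U` has Fourier spectrum
in `S` and `-2π ξ ∉ S` for every `ξ` in the support of the Schwartz function `D`, then
`∫ 𝓕⁻¹D(a) • U(a)ψ da = 0` (`𝓕⁻¹D = 𝓕(D(-·))`). [folklore] -/
theorem integral_fourierInv_smul_apply_eq_zero (U : UnitaryRep (Multiplicative P) H) {S : Set P}
    (hU : U.HasFourierSpectrumIn S) (D : 𝓢(P, ℂ))
    (hD : ∀ ξ ∈ tsupport (D : P → ℂ), (-(2 * Real.pi)) • ξ ∉ S) (ψ : H) :
    ∫ a, (𝓕⁻ D : 𝓢(P, ℂ)) a • U (Multiplicative.ofAdd a) ψ = 0 := by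
  set g : 𝓢(P, ℂ) := SchwartzMap.compCLMOfContinuousLinearEquiv ℂ
    (LinearIsometryEquiv.neg ℝ (E := P)).toContinuousLinearEquiv D with hg
  have hcoe : ((𝓕⁻ D : 𝓢(P, ℂ)) : P → ℂ) = ((𝓕 g : 𝓢(P, ℂ)) : P → ℂ) := by
    funext a
    rw [SchwartzMap.fourierInv_coe, SchwartzMap.fourier_coe, Real.fourierInv_eq_fourier_neg]
    exact (Real.fourier_comp_linearIsometry (LinearIsometryEquiv.neg ℝ (E := P)) _ a).symm
  rw [hcoe]
  refine U.integral_fourier_smul_apply_eq_zero hU g (fun ξ hξ hξS => ?_) ψ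
  have hξ' : -ξ ∈ tsupport (D : P → ℂ) := by
    have h := tsupport_comp_subset_preimage (D : P → ℂ) (continuous_neg (G := P))
    exact h hξ
  refine hD (-ξ) hξ' ?_
  simpa [smul_neg, neg_smul] using hξS

/-! ### Fourier lemmas: real symbols, dilations, total integral -/

/-- For a real symbol `G`, the kernel `k = 𝓕⁻¹G` is self-adjoint: `conj k(-a) = k(a)`. [folklore] -/
theorem conj_fourierInv_neg {G : P → ℂ}
    (hG : ∀ ξ, conj (G ξ) = G ξ) (a : P) :
    conj (𝓕⁻ G (-a)) = 𝓕⁻ G a := by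
  rw [Real.fourierInv_eq', Real.fourierInv_eq', ← integral_conj]
  refine integral_congr_ae (Eventually.of_forall fun v => ?_)
  simp only [smul_eq_mul, map_mul, hG, inner_neg_right, ← Complex.exp_conj, Complex.conj_ofReal,
    Complex.conj_I, mul_neg]
  congr 2
  push_cast
  ring

/-- Dilation of the symbol is an approximate-identity scaling of the kernel:
`𝓕⁻¹(G(R⁻¹ ·))(a) = Rᴰ 𝓕⁻¹G(R a)`, `D = dim P`. [folklore] -/
theorem fourierInv_comp_inv_smul (G : P → ℂ) {R : ℝ} (hR : 0 < R) (a : P) :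
    𝓕⁻ (fun v => G (R⁻¹ • v)) a = (R : ℂ) ^ Module.finrank ℝ P * 𝓕⁻ G (R • a) := by
  rw [Real.fourierInv_eq', Real.fourierInv_eq']
  simp only [smul_eq_mul]
  have h := Measure.integral_comp_inv_smul_of_nonneg volume
    (fun w : P => Complex.exp ((↑(2 * Real.pi * ⟪R • w, a⟫) : ℂ) * Complex.I) * G w) hR.le
  have h1 : (fun v : P => Complex.exp ((↑(2 * Real.pi * ⟪R • (R⁻¹ • v), a⟫) : ℂ) * Complex.I) *
      G (R⁻¹ • v)) =
      fun v : P => Complex.exp ((↑(2 * Real.pi * ⟪v, a⟫) : ℂ) * Complex.I) * G (R⁻¹ • v) := by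
    funext v
    rw [smul_inv_smul₀ hR.ne']
  rw [h1] at h
  rw [h, Complex.real_smul, Complex.ofReal_pow]
  congr 1
  refine integral_congr_ae (Eventually.of_forall fun w => ?_)
  simp only [real_inner_smul_left, real_inner_smul_right]

/-- The total integral of the kernel is the value of the symbol at the origin:
`∫ 𝓕⁻¹G = (𝓕𝓕⁻¹G)(0) = G(0)`. [folklore] -/
theorem integral_fourierInv_eq (G : 𝓢(P, ℂ)) : ∫ a, (𝓕⁻ G : 𝓢(P, ℂ)) a = G 0 := by
  have h : (𝓕 (𝓕⁻ G : 𝓢(P, ℂ)) : 𝓢(P, ℂ)) 0 = G 0 := by rw [fourier_fourierInv_eq]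
  rw [← h]
  change _ = 𝓕 ((𝓕⁻ G : 𝓢(P, ℂ)) : P → ℂ) 0
  rw [Real.fourier_eq]
  simp

/-! ### A smooth square root -/

/-- The function `r(v) = smoothTransition (4v/ε - 1) √v` is smooth on `ℝ` (it vanishes for
`v ≤ ε/4` and `√` is smooth on `v > 0`). [folklore] -/
theorem contDiff_smoothTransition_mul_sqrt {ε : ℝ} (hε : 0 < ε) :
    ContDiff ℝ ∞ fun v : ℝ => Real.smoothTransition (4 * v / ε - 1) * Real.sqrt v := by
  rw [contDiff_iff_contDiffAt]
  intro v
  by_cases hv : v < ε / 4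
  · have heq : (fun v : ℝ => Real.smoothTransition (4 * v / ε - 1) * Real.sqrt v) =ᶠ[𝓝 v]
        fun _ => 0 := by
      filter_upwards [Iio_mem_nhds hv] with w hw
      have hw' : 4 * w / ε - 1 ≤ 0 := by
        rw [sub_nonpos, div_le_one hε]
        have := (Set.mem_Iio.mp hw)
        linarith
      rw [Real.smoothTransition.zero_of_nonpos hw', zero_mul]
    exact contDiffAt_const.congr_of_eventuallyEq heq
  · push Not at hv
    have hv0 : 0 < v := lt_of_lt_of_le (by positivity) hv
    exact ((Real.smoothTransition.contDiff.comp (by fun_prop)).contDiffAt).mul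
      (Real.contDiffAt_sqrt hv0.ne')

/-- `r(v)² = v` for `v ≥ ε/2`. [folklore] -/
theorem smoothTransition_mul_sqrt_sq {ε v : ℝ} (hε : 0 < ε) (hv : ε / 2 ≤ v) :
    (Real.smoothTransition (4 * v / ε - 1) * Real.sqrt v) ^ 2 = v := by
  have h1 : 1 ≤ 4 * v / ε - 1 := by
    rw [le_sub_iff_add_le, le_div_iff₀ hε]
    linarith
  rw [Real.smoothTransition.one_of_one_le h1, one_mul, Real.sq_sqrt (by linarith)]

/-! ### The core inequality for smeared vectors -/

/-- **Core inequality.** Let `U` have Fourier spectrum in `S ⊆ {p | 0 ≤ ⟪p, e⟫}`, let `ε > 0`, let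
`G ∈ C_c^∞(P)` be real and `k = 𝓕⁻¹G`. For `x ∈ D(A_e)` and the smeared vectors
`y = ∫ k(a) U(a) x da`, `y' = ∫ k(a) U(a) A_e x da` one has `0 ≤ Im ⟪y, y'⟫ + ε ‖y‖²`
(steps 1–3 of the module docstring: `⟪y, -i y' + ε y⟫ = ‖∫ m(a) U(a) x da‖²`,
`m = 𝓕⁻¹(r(ε - 2π⟪·,e⟫) G)`; Streater–Wightman (1964), §3-1). [cite: StreaterWightman1964, §3-1] -/
theorem im_inner_smear_smear_generator_add_nonneg (U : UnitaryRep (Multiplicative P) H)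
    {S : Set P} (hU : U.HasFourierSpectrumIn S) (e : P) (hS : ∀ p ∈ S, 0 ≤ ⟪p, e⟫)
    {ε : ℝ} (hε : 0 < ε) {G : P → ℝ} (hG : HasCompactSupport G) (hGs : ContDiff ℝ ∞ G)
    (x : (OneParameterGroup.generator (U.alongDirection e).toStrongContRepresentation).domain) :
    0 ≤ (⟪∫ a, 𝓕⁻ (fun ξ => (G ξ : ℂ)) a • U (Multiplicative.ofAdd a) (x : H),
          ∫ a, 𝓕⁻ (fun ξ => (G ξ : ℂ)) a • U (Multiplicative.ofAdd a)
            (OneParameterGroup.generator (U.alongDirection e).toStrongContRepresentation x)⟫_ℂ).im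
      + ε * ‖∫ a, 𝓕⁻ (fun ξ => (G ξ : ℂ)) a • U (Multiplicative.ofAdd a) (x : H)‖ ^ 2 := by
  -- the symbols: `u = ε - 2π⟪·,e⟩`, square root `ρ`, and `G`, `Q = u G`, `M = ρ G`
  set u : P → ℝ := fun ξ => ε - 2 * Real.pi * ⟪ξ, e⟫ with hu
  set ρ : P → ℝ := fun ξ => Real.smoothTransition (4 * u ξ / ε - 1) * Real.sqrt (u ξ) with hρ
  have hu_smooth : ContDiff ℝ ∞ u :=
    contDiff_const.sub (contDiff_const.mul (contDiff_id.inner ℝ contDiff_const))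
  have hρ_smooth : ContDiff ℝ ∞ ρ := (contDiff_smoothTransition_mul_sqrt hε).comp hu_smooth
  have hρ_sq : ∀ ξ, ⟪ξ, e⟫ < ε / (4 * Real.pi) → ρ ξ ^ 2 = u ξ := by
    intro ξ hξ
    refine smoothTransition_mul_sqrt_sq hε ?_
    have h2 : 2 * Real.pi * ⟪ξ, e⟫ < ε / 2 := by
      have := mul_lt_mul_of_pos_left hξ (by positivity : (0 : ℝ) < 2 * Real.pi)
      rwa [show 2 * Real.pi * (ε / (4 * Real.pi)) = ε / 2 by field_simp; ring] at this
    simp only [hu]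
    linarith
  have hQc : HasCompactSupport fun ξ => u ξ * G ξ := hG.mul_left (f := u)
  have hQs : ContDiff ℝ ∞ fun ξ => u ξ * G ξ := hu_smooth.mul hGs
  have hMc : HasCompactSupport fun ξ => ρ ξ * G ξ := hG.mul_left (f := ρ)
  have hMs : ContDiff ℝ ∞ fun ξ => ρ ξ * G ξ := hρ_smooth.mul hGs
  -- the Schwartz symbols and kernels
  set Gs : 𝓢(P, ℂ) := (hG.comp_left Complex.ofReal_zero).toSchwartzMap
    (Complex.ofRealCLM.contDiff.comp hGs) with hGs_def
  set Qs : 𝓢(P, ℂ) := (hQc.comp_left Complex.ofReal_zero).toSchwartzMap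
    (Complex.ofRealCLM.contDiff.comp hQs) with hQs_def
  set Ms : 𝓢(P, ℂ) := (hMc.comp_left Complex.ofReal_zero).toSchwartzMap
    (Complex.ofRealCLM.contDiff.comp hMs) with hMs_def
  have hGs_coe : (Gs : P → ℂ) = fun ξ => (G ξ : ℂ) := rfl
  have hQs_coe : (Qs : P → ℂ) = fun ξ => ((u ξ * G ξ : ℝ) : ℂ) := rfl
  have hMs_coe : (Ms : P → ℂ) = fun ξ => ((ρ ξ * G ξ : ℝ) : ℂ) := rfl
  set ks : 𝓢(P, ℂ) := 𝓕⁻ Gs with hks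
  set qs : 𝓢(P, ℂ) := 𝓕⁻ Qs with hqs
  set ms : 𝓢(P, ℂ) := 𝓕⁻ Ms with hms
  have hk_coe : (𝓕⁻ (fun ξ => (G ξ : ℂ)) : P → ℂ) = (ks : P → ℂ) := by
    rw [hks, SchwartzMap.fourierInv_coe, hGs_coe]
  rw [hk_coe]
  -- the smeared vectors
  set y : H := ∫ a, ks a • U (Multiplicative.ofAdd a) (x : H) with hy
  set y' : H := ∫ a, ks a • U (Multiplicative.ofAdd a)
    (OneParameterGroup.generator (U.alongDirection e).toStrongContRepresentation x) with hy'
  set z : H := ∫ a, ms a • U (Multiplicative.ofAdd a) (x : H) with hz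
  -- Step 1: `-i y' + ε y = ∫ q(a) U(a) x da`, from the symbol identity
  -- `i (2πi ⟪ξ,e⟫) G + ε G = (ε - 2π⟪ξ,e⟫) G`
  have hsym : Complex.I • (∂_{e} ks : 𝓢(P, ℂ)) + (ε : ℂ) • ks = qs := by
    have hT : (fun ξ : P => ⟪ξ, e⟫).HasTemperateGrowth := by fun_prop
    rw [hks, SchwartzMap.lineDerivOp_fourierInv_eq, ← fourierInv_smul, ← fourierInv_smul,
      ← fourierInv_add, hqs]
    congr 1
    ext ξ
    simp only [add_apply, smul_apply, smul_eq_mul, SchwartzMap.smulLeftCLM_apply_apply hT,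
      hGs_coe, hQs_coe, hu, Complex.real_smul]
    push_cast
    linear_combination (2 * (Real.pi : ℂ) * ((⟪ξ, e⟫ : ℂ) * (G ξ : ℂ))) * Complex.I_sq
  have h1 : (-Complex.I) • y' + (ε : ℂ) • y = ∫ a, qs a • U (Multiplicative.ofAdd a) (x : H) := by
    have hparts := U.integral_smul_apply_generator_eq_neg e ks x
    rw [hy', hparts, smul_neg, neg_smul, neg_neg, hy,
      ← U.integral_const_mul_smul_apply _ Complex.I, ← U.integral_const_mul_smul_apply _ (ε : ℂ),
      ← U.integral_add_smul_apply
        (((∂_{e} ks : 𝓢(P, ℂ)).integrable).const_mul _) (ks.integrable.const_mul _)]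
    refine integral_congr_ae (Eventually.of_forall fun a => ?_)
    have ha := DFunLike.congr_fun hsym a
    simp only [add_apply, smul_apply, smul_eq_mul] at ha
    dsimp only
    rw [ha]
  -- Step 2: products and adjoints, `⟪W[k]x, W[q]x⟫ = ⟪x, W[k ⋆ q]x⟫`, `‖W[m]x‖² = ⟪x, W[m ⋆ m]x⟫`
  have hGreal : ∀ ξ, conj (Gs ξ) = Gs ξ := fun ξ => by
    rw [hGs_coe]; exact Complex.conj_ofReal _
  have hMreal : ∀ ξ, conj (Ms ξ) = Ms ξ := fun ξ => by
    rw [hMs_coe]; exact Complex.conj_ofReal _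
  have hk_adj : ∀ a, conj (ks (-a)) = ks a := fun a => by
    rw [hks, SchwartzMap.fourierInv_coe]; exact conj_fourierInv_neg hGreal a
  have hm_adj : ∀ a, conj (ms (-a)) = ms a := fun a => by
    rw [hms, SchwartzMap.fourierInv_coe]; exact conj_fourierInv_neg hMreal a
  have hconv : ∀ (f g : 𝓢(P, ℂ)) (s : P), ∫ t, f t * g (s - t) =
      (SchwartzMap.convolution (ContinuousLinearMap.mul ℂ ℂ) f g : 𝓢(P, ℂ)) s := by
    intro f g s
    rw [SchwartzMap.convolution_apply, convolution_def]
    simp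
  have h2 : ⟪y, ∫ a, qs a • U (Multiplicative.ofAdd a) (x : H)⟫_ℂ =
      ⟪(x : H), ∫ a, (SchwartzMap.convolution (ContinuousLinearMap.mul ℂ ℂ) ks qs : 𝓢(P, ℂ)) a •
        U (Multiplicative.ofAdd a) (x : H)⟫_ℂ := by
    rw [hy, U.inner_integral_smul_apply_left ks.integrable]
    simp_rw [hk_adj]
    rw [U.integral_smul_apply_integral_smul_apply ks.integrable qs.integrable]
    simp_rw [hconv]
  have h3 : ⟪z, z⟫_ℂ =
      ⟪(x : H), ∫ a, (SchwartzMap.convolution (ContinuousLinearMap.mul ℂ ℂ) ms ms : 𝓢(P, ℂ)) a •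
        U (Multiplicative.ofAdd a) (x : H)⟫_ℂ := by
    rw [hz, U.inner_integral_smul_apply_left ms.integrable]
    simp_rw [hm_adj]
    rw [U.integral_smul_apply_integral_smul_apply ms.integrable ms.integrable]
    simp_rw [hconv]
  -- Step 3: the difference kernel has symbol supported in `{⟪ξ, e⟫ ≥ ε/4π}`, hence smears to 0
  set δ : 𝓢(P, ℂ) := SchwartzMap.convolution (ContinuousLinearMap.mul ℂ ℂ) ks qs -
    SchwartzMap.convolution (ContinuousLinearMap.mul ℂ ℂ) ms ms with hδ
  have hFδ : (𝓕 δ : 𝓢(P, ℂ)) = SchwartzMap.pairing (ContinuousLinearMap.mul ℂ ℂ) Gs Qs -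
      SchwartzMap.pairing (ContinuousLinearMap.mul ℂ ℂ) Ms Ms := by
    rw [hδ, sub_eq_add_neg, FourierTransform.fourier_add, FourierTransform.fourier_neg,
      ← sub_eq_add_neg,
      SchwartzMap.fourier_convolution, SchwartzMap.fourier_convolution, hks, hqs, hms,
      fourier_fourierInv_eq, fourier_fourierInv_eq, fourier_fourierInv_eq]
  have hsupp : ∀ ξ ∈ tsupport ((𝓕 δ : 𝓢(P, ℂ)) : P → ℂ), (-(2 * Real.pi)) • ξ ∉ S := by
    intro ξ hξ hξS
    have hclosed : IsClosed {ξ : P | ε / (4 * Real.pi) ≤ ⟪ξ, e⟫} :=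
      isClosed_le continuous_const (continuous_id.inner continuous_const)
    have hsub : tsupport ((𝓕 δ : 𝓢(P, ℂ)) : P → ℂ) ⊆ {ξ : P | ε / (4 * Real.pi) ≤ ⟪ξ, e⟫} := by
      refine closure_minimal (fun ξ hξ => ?_) hclosed
      by_contra hlt
      simp only [Set.mem_setOf_eq, not_le] at hlt
      apply hξ
      rw [hFδ]
      simp only [sub_apply, SchwartzMap.pairing_apply_apply,
        ContinuousLinearMap.mul_apply', hGs_coe, hQs_coe, hMs_coe]
      have hsq := hρ_sq ξ hlt
      push_cast
      have hu' : (u ξ : ℂ) = (ρ ξ : ℂ) ^ 2 := by rw [← Complex.ofReal_pow, hsq]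
      rw [hu']
      ring
    have hle := hsub hξ
    simp only [Set.mem_setOf_eq] at hle
    have h0 := hS _ hξS
    rw [real_inner_smul_left] at h0
    have hpos : 0 < ⟪ξ, e⟫ := lt_of_lt_of_le (by positivity) hle
    nlinarith [Real.pi_pos]
  have h4 : ∫ a, δ a • U (Multiplicative.ofAdd a) (x : H) = 0 := by
    have h := U.integral_fourierInv_smul_apply_eq_zero hU (𝓕 δ) hsupp (x : H)
    rwa [fourierInv_fourier_eq] at h
  -- Step 4: assemble, `⟪y, -i y' + ε y⟫ = ⟪z, z⟫`
  have h5 : ⟪y, (-Complex.I) • y' + (ε : ℂ) • y⟫_ℂ = ⟪z, z⟫_ℂ := by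
    rw [h1, h2, h3, ← sub_eq_zero, ← inner_sub_right,
      ← U.integral_sub_smul_apply (SchwartzMap.integrable _) (SchwartzMap.integrable _)]
    have : (fun a => ((SchwartzMap.convolution (ContinuousLinearMap.mul ℂ ℂ) ks qs : 𝓢(P, ℂ)) a -
        (SchwartzMap.convolution (ContinuousLinearMap.mul ℂ ℂ) ms ms : 𝓢(P, ℂ)) a) •
          U (Multiplicative.ofAdd a) (x : H)) =
        fun a => δ a • U (Multiplicative.ofAdd a) (x : H) := by
      funext a
      rw [hδ, sub_apply]
    rw [this, h4, inner_zero_right]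
  have h6 : (⟪y, (-Complex.I) • y' + (ε : ℂ) • y⟫_ℂ).re = (⟪y, y'⟫_ℂ).im + ε * ‖y‖ ^ 2 := by
    have hyy : (⟪y, y⟫_ℂ).re = ‖y‖ ^ 2 := by
      have := inner_self_eq_norm_sq (𝕜 := ℂ) y
      simpa using this
    rw [inner_add_right, inner_smul_right, inner_smul_right]
    simp only [Complex.add_re, Complex.mul_re, Complex.neg_re, Complex.I_re, neg_zero, zero_mul,
      Complex.neg_im, Complex.I_im, zero_sub, Complex.ofReal_re, Complex.ofReal_im,
      sub_zero, hyy]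
    ring
  rw [← h6, h5]
  exact inner_self_nonneg (𝕜 := ℂ) (x := z)

/-! ### Positivity of the energy -/

/-- **Half-space spectral condition ⟹ positive energy.** If the translations `U` have Fourier
spectrum in a set `S` with `0 ≤ ⟪p, e⟫` for all `p ∈ S`, then the Hamiltonian of the
one-parameter group `t ↦ U(t e)` is positive: `(U.alongDirection e).HasPositiveEnergy`, i.e.
`0 ≤ ⟪x, H_e x⟫` on `D(H_e)` (and `H_e` is symmetric). For `S = V̄₊`, `e = e₀` this is the
positivity of the energy `P⁰ ≥ 0` in a theory with the spectral condition (Streater–Wightman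
(1964), §3-1, (3-3)–(3-4)); the proof (module docstring) avoids the spectral theorem.
[cite: StreaterWightman1964, §3-1] -/
theorem hasPositiveEnergy_alongDirection_of_hasFourierSpectrumIn
    (U : UnitaryRep (Multiplicative P) H) {S : Set P} (hU : U.HasFourierSpectrumIn S) (e : P)
    (hS : ∀ p ∈ S, 0 ≤ ⟪p, e⟫) : (U.alongDirection e).HasPositiveEnergy := by
  refine ⟨(U.alongDirection e).hamiltonian_isSymmetric, fun x => ?_⟩
  have hre : RCLike.re ⟪(x : H), (U.alongDirection e).hamiltonian x⟫_ℂ =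
      (⟪(x : H), (OneParameterGroup.generator (U.alongDirection e).toStrongContRepresentation x :
        H)⟫_ℂ).im := by
    rw [hamiltonian_apply, inner_smul_right]
    simp only [RCLike.re_to_complex, neg_mul, Complex.neg_re, Complex.mul_re, Complex.I_re,
      zero_mul, Complex.I_im, one_mul, zero_sub, neg_neg]
  rw [hre]
  set A := OneParameterGroup.generator (U.alongDirection e).toStrongContRepresentation with hA
  -- a bump symbol `b` with `b(0) = 1`, its dilates `G_R = b(R⁻¹ ·)`, and the kernel `k₁ = 𝓕⁻¹b`
  let b : ContDiffBump (0 : P) := ⟨1, 2, one_pos, one_lt_two⟩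
  have hbc : HasCompactSupport (b : P → ℝ) := b.hasCompactSupport
  have hbs : ContDiff ℝ ∞ (b : P → ℝ) := b.contDiff
  set bs : 𝓢(P, ℂ) := (hbc.comp_left Complex.ofReal_zero).toSchwartzMap
    (Complex.ofRealCLM.contDiff.comp hbs) with hbs_def
  have hbs_coe : (bs : P → ℂ) = fun ξ => ((b : P → ℝ) ξ : ℂ) := rfl
  have hGc : ∀ R : ℝ, 0 < R → HasCompactSupport fun ξ : P => (b : P → ℝ) (R⁻¹ • ξ) :=
    fun R hR => hbc.comp_smul (inv_ne_zero hR.ne')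
  have hGs : ∀ R : ℝ, ContDiff ℝ ∞ fun ξ : P => (b : P → ℝ) (R⁻¹ • ξ) :=
    fun R => hbs.comp (contDiff_const_smul _)
  -- the kernels `𝓕⁻¹ G_R = Rᴰ k₁(R ·)` form an approximate identity with `∫ k₁ = b 0 = 1`
  have hscale : ∀ R : ℝ, 0 < R → ∀ a : P,
      𝓕⁻ (fun ξ : P => (((b : P → ℝ) (R⁻¹ • ξ) : ℝ) : ℂ)) a =
        (R : ℂ) ^ Module.finrank ℝ P * (𝓕⁻ bs : 𝓢(P, ℂ)) (R • a) := by
    intro R hR a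
    rw [SchwartzMap.fourierInv_coe, hbs_coe]
    exact fourierInv_comp_inv_smul (fun ξ : P => (((b : P → ℝ) ξ : ℝ) : ℂ)) hR a
  have hint : ∫ a, (𝓕⁻ bs : 𝓢(P, ℂ)) a = 1 := by
    rw [integral_fourierInv_eq, hbs_coe]
    simp only
    rw [b.one_of_mem_closedBall (Metric.mem_closedBall_self b.rIn_pos.le), Complex.ofReal_one]
  have happrox : ∀ v : H, Tendsto (fun R : ℝ =>
      ∫ a, 𝓕⁻ (fun ξ : P => (((b : P → ℝ) (R⁻¹ • ξ) : ℝ) : ℂ)) a • U (Multiplicative.ofAdd a) v)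
      atTop (𝓝 v) := by
    intro v
    have h := U.tendsto_integral_dilate_smul_apply (𝓕⁻ bs : 𝓢(P, ℂ)).integrable v
    rw [hint, one_smul] at h
    refine h.congr' ?_
    filter_upwards [eventually_gt_atTop 0] with R hR
    refine integral_congr_ae (Eventually.of_forall fun a => ?_)
    dsimp only
    rw [hscale R hR a]
  -- `Im ⟪x, A x⟫ ≥ -ε ‖x‖²` for every `ε > 0`
  have hε : ∀ ε : ℝ, 0 < ε → -(ε * ‖(x : H)‖ ^ 2) ≤ (⟪(x : H), (A x : H)⟫_ℂ).im := by
    intro ε hε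
    have hlim : Tendsto (fun R : ℝ =>
        (⟪∫ a, 𝓕⁻ (fun ξ : P => (((b : P → ℝ) (R⁻¹ • ξ) : ℝ) : ℂ)) a •
            U (Multiplicative.ofAdd a) (x : H),
          ∫ a, 𝓕⁻ (fun ξ : P => (((b : P → ℝ) (R⁻¹ • ξ) : ℝ) : ℂ)) a •
            U (Multiplicative.ofAdd a) (A x : H)⟫_ℂ).im
        + ε * ‖∫ a, 𝓕⁻ (fun ξ : P => (((b : P → ℝ) (R⁻¹ • ξ) : ℝ) : ℂ)) a •
            U (Multiplicative.ofAdd a) (x : H)‖ ^ 2)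
        atTop (𝓝 ((⟪(x : H), (A x : H)⟫_ℂ).im + ε * ‖(x : H)‖ ^ 2)) :=
      ((Complex.continuous_im.tendsto _).comp ((happrox x).inner (happrox (A x)))).add
        (((happrox x).norm.pow 2).const_mul ε)
    have hpos : ∀ᶠ R : ℝ in atTop, 0 ≤
        (⟪∫ a, 𝓕⁻ (fun ξ : P => (((b : P → ℝ) (R⁻¹ • ξ) : ℝ) : ℂ)) a •
            U (Multiplicative.ofAdd a) (x : H),
          ∫ a, 𝓕⁻ (fun ξ : P => (((b : P → ℝ) (R⁻¹ • ξ) : ℝ) : ℂ)) a •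
            U (Multiplicative.ofAdd a) (A x : H)⟫_ℂ).im
        + ε * ‖∫ a, 𝓕⁻ (fun ξ : P => (((b : P → ℝ) (R⁻¹ • ξ) : ℝ) : ℂ)) a •
            U (Multiplicative.ofAdd a) (x : H)‖ ^ 2 := by
      filter_upwards [eventually_gt_atTop 0] with R hR
      exact U.im_inner_smear_smear_generator_add_nonneg hU e hS hε (hGc R hR) (hGs R) x
    have := ge_of_tendsto hlim hpos
    linarith
  -- let `ε → 0`
  refine le_of_forall_pos_le_add fun ε hε0 => ?_
  have h := hε (ε / (‖(x : H)‖ ^ 2 + 1)) (by positivity)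
  have hx : -(ε / (‖(x : H)‖ ^ 2 + 1) * ‖(x : H)‖ ^ 2) ≥ -ε := by
    rw [ge_iff_le, neg_le_neg_iff, div_mul_eq_mul_div, div_le_iff₀ (by positivity)]
    nlinarith [sq_nonneg ‖(x : H)‖]
  linarith

end UnitaryRep

end Literature.Analysis.UnboundedOperators
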